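/-
Copyright: the b2b-balaban cell (near-miss cell 7), T⁴-continuum fan-out; row NE7b ROUND-2 swarm, seat
t4-ne7b-formalise-leaf-03 (row S12 «ASSEMBLY» of `t4/b2b-balaban-t4-ne7b-p1/LEAVES-NE7b.md`; node A12 of the typer's
`t4/formal/NE7b/DAG.md`).  Released under the licence of the surrounding project.
-/
import Summits.QuantumFields.BalabanUV.T4Continuum.Support.HistoryAssemblyTrees
import Summits.QuantumFields.BalabanUV.T4Continuum.Support.HistorySocketTH

/-!
# History assembly, TERM-KEYED: the tree-slot exit's four (ID) binders built from a per-term reading of the live structures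

Summits-side support leaf of the T⁴-continuum cell (rung (B)+1 on a FINITE torus only; NOT infinite volume, NOT the
mass gap, NOT the Clay statement; NOT a proof of the spine estimate NE7b).  Row NE7b, route «COUNT», ROUND-2 swarm
row S12 §5 (journal INTENT l.6120).  [folklore] finite combinatorics + COMPOSITION BY NAME over the cell's own carrier;
nothing is quoted from print, nothing printed is asserted, no `[cite:]` tag, no `Prop`-valued fact of Bałaban's is
minted (trigger c1): the reading H3 enters as DISPLAYED hypotheses about an abstract term family, (B) and the
BetaPertH-flow facts as the displayed binders of `HistoryAssemblyTrees.hybridNE7_of_treeBinders_canon` (c4).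

WHY.  After `HistoryAssemblyTrees` (S12 §3) the only (ID)-side inputs of the NE7b COUNT exit are the FOUR TREE-SLOT
BINDERS — a labelled price `y K j z G` on the counted slots with `hlabT`, live slot families `str K c` of the bad classes
with `hinj`∕`hstr`, and the dominations `hF`∕`hF′` — all keyed by CLASSES (`κ`, `π`, `Bad′` of the `Regeneration`
reading).  H3 — print's inductive description of the terms of the density after `K` steps, read onto the typed
histories — speaks of TERMS: every term `τ ∈ T K` has a finite set of LIVE STRUCTURES, each a (root cell, tagged
genealogy) pair.  This file is the layer in between (ruling R-OWNER-22-1 R4∕Q5: «classes KEYED by bslot families, so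
`str_inj` is definitional and `old` by `mem_filter`»): from a per-term member map `mem : ℕ → ι → Finset (γ × Gen ε)` it
takes the live class of a term to be its bslot family (the socket's `HistorySocketTH.bstrOf sh mem K τ`, keyed by TERMS), DEFINES, the bad terms (an OLD member, born before `j⋆ K`) and bad
classes (`badClasses`), the occupants of a tree slot and the labelled price `yT` (the MAXIMUM of the member price over the
slot's occupants among bad terms' members — no representative is chosen, no tag-invariance is needed), and PROVES the
four binders from per-member facts (exactly the per-member fields of socket v3, typer DAG §0: `ConsistentT`, `FreshT`,
pending, `cell_mem`, `Chrono` + caps), within-term bslot-injectivity (disjoint regions of ONE term have distinct root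
cells) and a per-term PRICE READING.  §4 plugs them into the exit: **`hybridNE7_of_termReading_canon`**.

WHAT.  §1 `badTerms`, `badClasses` (+ membership lemmas, `badClasses_subset_classIndex` — the
`Regeneration` field `bad_subset` becomes a THEOREM).  §2 `priceT` (the tree-slot labelled price of a member:
`Λ′^{partnerAges}·e^{−credits∘sh}·e^{+lifeCost costT}`), `occ` (occupants), `yT`, `priceT_le_yT`, `yT_nonneg`.  §3 the
hypothesis structure `TermReading` (per-member facts on bad terms' members + within-term injectivity) and the binders
`hlabT_of_termReading`, `hstr_of_termReading`, `hF_of_priceReading`.  §4 the END statement.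

WHAT REMAINS DISPLAYED AFTER §4 (the census of row S12 at this point).  CONSTANTS ∕ FLOW ∕ (B) ∕ SEAM: as in
`HistoryAssemblyTrees` (module docstring there).  H3, PER TERM: the member map `mem`; `TermReading sh C d n F.L Dcap
Ncap K₀ R T mem` (the per-member facts — to be DISCHARGED by rows S3∕S4∕S5∕S7 for `mem K τ :=` the live members of the
admissible history of `τ` under the displayed `RenewAtReach`); the per-term price readings `hprice`∕`hprice′` (row S10's
TH comparison turns them into «printed per-operation factors × `Dominates`»; the zone-crowding part of the (GM)
multiplicity joins when row S6e lands, at `lowerA`); and the four remaining `Regeneration` numerator fields per run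
(`up`, `dead_nonneg`, `resum`, `F_nonneg`) over the class map `bstrOf sh mem` and the DEFINED bad classes `badClasses`.

HEADLINE (c4): «COUNT route, tree-slot form: exit + seam with every kernel-able binder plugged; H3 displayed PER TERM,
(B) + BetaPertH-flow + NE7c socket + NE7 core budget displayed» — NOT «NE7b proved».  HONEST DEPENDENCY (cell): continuum
YM on T⁴ ⇐ BetaPertH ∧ nine spine estimates (0/9 proved); BetaPertH ⇐ (D1) ∧ (D4) ∧ CAP+tail.  This file changes none of it.
-/

open Finset MeasureTheory
open Literature.MathematicalPhysics.QuantumFieldTheory.Balaban1983to89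
open T4PersistenceDictionary T4PersistentHistoryCount T4BankedInduction T4PrintedShapeBanking
open T4WeightBudget T4GlobalDenominator T4LiveClassFibration T4LiveStructureGas T4LiveGasToTerms T4RecordPriceSeam
open T4PartnerMultiplicity T4IndicatorShell T4MatchingAssembly T4MatchingClosure T4MatchingClosureSocket T4Continuum
open T4StabilitySocket T4BranchingRecordsGas T4TaggedShapeBanking T4CanonicalMenus T4RenewalChains
open Summit.QuantumFields.BalabanUV.T4Continuum.PlacementBatch
open Summit.QuantumFields.BalabanUV.T4Continuum.PlacementSkeleton
open Summit.QuantumFields.BalabanUV.T4Continuum.CountThresholdUniform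
open Summit.QuantumFields.BalabanUV.T4Continuum.CountThresholdExit
open Summit.QuantumFields.BalabanUV.T4Continuum.CountSeamJunction
open Summit.QuantumFields.BalabanUV.T4Continuum.LateMergers
open Summit.QuantumFields.BalabanUV.T4Continuum.HistoryFlow
open Summit.QuantumFields.BalabanUV.T4Continuum.HistoryRegeneration
open Summit.QuantumFields.BalabanUV.T4Continuum.HistoryTables
open Summit.QuantumFields.BalabanUV.T4Continuum.HistoryAssemblyTrees
open Summit.QuantumFields.BalabanUV.T4Continuum.HistorySocketTH

namespace Summit.QuantumFields.BalabanUV.T4Continuum.HistoryAssemblyTerms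

noncomputable section

/-! ## §1 Term data: the bslot of a member, the live class of a term, bad terms and bad classes -/

section TermData

variable {ε γ ι : Type*}

/-- decidable equality of tree slots — the nested-Σ abbreviation `BSlot γ PEv` of `T4BranchingRecordsGas` — named, so
that instance search finds it under `Finset` (families of tree slots are the live classes below, and classes are
compared for equality in `classIndex`∕`fibre`). [folklore] -/
instance instDecidableEqBSlot [DecidableEq γ] : DecidableEq (BSlot γ PEv) := inferInstance

/-- the components of a member's tree slot `HistorySocketTH.bslotOf sh (z, G′) = ⟨rootStep, z, shape tree⟩` [folklore] -/
theorem bslotOf_eq_iff (sh : ε → PEv) (q : γ × Gen ε) (j : ℕ) (z : γ) (Gs : Gen PEv) :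
    bslotOf sh q = ⟨j, z, Gs⟩ ↔ q.2.rootStep = j ∧ q.1 = z ∧ relabel (shape ∘ sh) q.2 = Gs := by
  simp only [bslotOf, Sigma.mk.inj_iff, heq_eq_eq]

/-- **THE BAD TERMS** at cutoff `K`: the terms with an OLD live member (born before the matching scale `j⋆ K`) — the
persistent large-field histories. [folklore] -/
def badTerms (mem : ℕ → ι → Finset (γ × Gen ε)) (jstar : ℕ → ℕ) (T : ℕ → Finset ι) (K : ℕ) : Finset ι :=
  (T K).filter fun τ => ((mem K τ).filter fun q => q.2.rootStep < jstar K).Nonempty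

/-- membership in the bad terms [folklore] -/
theorem mem_badTerms {mem : ℕ → ι → Finset (γ × Gen ε)} {jstar : ℕ → ℕ} {T : ℕ → Finset ι} {K : ℕ} {τ : ι} :
    τ ∈ badTerms mem jstar T K ↔ τ ∈ T K ∧ ∃ q ∈ mem K τ, q.2.rootStep < jstar K := by
  simp only [badTerms, mem_filter, filter_nonempty_iff]

variable [DecidableEq γ] [DecidableEq ε]

/- THE LIVE CLASS OF A TERM at cutoff `K` is the socket's branching slot family `HistorySocketTH.bstrOf sh mem K τ =
(mem K τ).image (bslotOf sh)` of its member set (the socket's `live`, keyed here by TERMS). -/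

/-- **THE BAD CLASSES** at cutoff `K`: the live classes of the bad terms (the same at every source `t`). [folklore] -/
def badClasses (sh : ε → PEv) (mem : ℕ → ι → Finset (γ × Gen ε)) (jstar : ℕ → ℕ) (T : ℕ → Finset ι) (K : ℕ) :
    Finset (Finset (BSlot γ PEv)) :=
  (badTerms mem jstar T K).image (bstrOf sh mem K)

omit [DecidableEq ε] in
/-- a bad class is the class of a bad term [folklore] -/
theorem mem_badClasses {sh : ε → PEv} {mem : ℕ → ι → Finset (γ × Gen ε)} {jstar : ℕ → ℕ} {T : ℕ → Finset ι} {K : ℕ}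
    {c : Finset (BSlot γ PEv)} :
    c ∈ badClasses sh mem jstar T K ↔ ∃ τ ∈ badTerms mem jstar T K, bstrOf sh mem K τ = c := mem_image

omit [DecidableEq ε] in
/-- **`Regeneration.bad_subset` IS A THEOREM**: the bad classes are live classes of actual terms. [folklore] -/
theorem badClasses_subset_classIndex (sh : ε → PEv) (mem : ℕ → ι → Finset (γ × Gen ε)) (jstar : ℕ → ℕ)
    (T : ℕ → Finset ι) (K : ℕ) : badClasses sh mem jstar T K ⊆ classIndex (bstrOf sh mem) T K :=
  image_subset_image (filter_subset _ _)

end TermData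

/-! ## §2 The member price, the occupants of a tree slot, the labelled price -/

section Price

variable {ε γ ι : Type*} [DecidableEq γ] [DecidableEq ε]

/-- **THE TREE-SLOT PRICE OF A LIVE MEMBER** at cutoff `K` (the right-hand side of the exit's `hlabT` at `D = 0`,
`Δ = 1`): `Λ′^{partnerAges}·e^{−credits (credit C (g K) ∘ sh)}·e^{+lifeCost (dictWT sh (R K) n₁) (costT sh C K (R K))}` of
its tagged genealogy. [folklore] -/
def priceT (sh : ε → PEv) (C : T4PrintedShapeBanking.Consts) (Λ' : ℝ) (R : ℕ → ℕ → ℕ) (g : ℕ → ℕ → ℝ) (K : ℕ)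
    (q : γ × Gen ε) : ℝ :=
  Λ' ^ partnerAges (PEv.step ∘ sh) q.2 *
    (Real.exp (-credits (credit C (g K) ∘ sh) q.2) *
      Real.exp (lifeCost (dictWT sh (R K) C.n₁) (costT sh C K (R K)) q.2))

omit [DecidableEq γ] in
/-- the member price is nonnegative (`Λ′ ≥ 0`) [folklore] -/
theorem priceT_nonneg (sh : ε → PEv) (C : T4PrintedShapeBanking.Consts) {Λ' : ℝ} (hΛ : 0 ≤ Λ') (R : ℕ → ℕ → ℕ)
    (g : ℕ → ℕ → ℝ) (K : ℕ) (q : γ × Gen ε) : 0 ≤ priceT sh C Λ' R g K q :=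
  mul_nonneg (pow_nonneg hΛ _) (by positivity)

omit [DecidableEq γ] in
/-- the member price is the socket's ∕ the exit's per-member shape at `Δ = 1`, `D = 0`
(`HistorySocketTH.shapeTH`; `padW W 0 = W`). [folklore] -/
theorem priceT_eq_shapeTH (sh : ε → PEv) (C : T4PrintedShapeBanking.Consts) (Λ' : ℝ) (R : ℕ → ℕ → ℕ)
    (g : ℕ → ℕ → ℝ) (K : ℕ) (q : γ × Gen ε) : priceT sh C Λ' R g K q = shapeTH sh C Λ' 1 R g 0 K q.2 := by
  rw [priceT, shapeTH, one_mul, padW_zero]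

/-- **THE OCCUPANTS OF A TREE SLOT** at cutoff `K`: the live members of BAD terms sitting at that slot. [folklore] -/
def occ (sh : ε → PEv) (mem : ℕ → ι → Finset (γ × Gen ε)) (jstar : ℕ → ℕ) (T : ℕ → Finset ι) (K : ℕ)
    (s : BSlot γ PEv) : Finset (γ × Gen ε) :=
  (badTerms mem jstar T K).biUnion fun τ => (mem K τ).filter fun q => bslotOf sh q = s

/-- membership in the occupants [folklore] -/
theorem mem_occ {sh : ε → PEv} {mem : ℕ → ι → Finset (γ × Gen ε)} {jstar : ℕ → ℕ} {T : ℕ → Finset ι} {K : ℕ}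
    {s : BSlot γ PEv} {q : γ × Gen ε} :
    q ∈ occ sh mem jstar T K s ↔ ∃ τ ∈ badTerms mem jstar T K, q ∈ mem K τ ∧ bslotOf sh q = s := by
  simp only [occ, mem_biUnion, mem_filter]

/-- **THE LABELLED PRICE OF A TREE SLOT**: the MAXIMUM of the member price over the slot's occupants; `0` on an
unoccupied slot. [folklore] -/
def yT (sh : ε → PEv) (C : T4PrintedShapeBanking.Consts) (Λ' : ℝ) (R : ℕ → ℕ → ℕ) (g : ℕ → ℕ → ℝ)
    (mem : ℕ → ι → Finset (γ × Gen ε)) (jstar : ℕ → ℕ) (T : ℕ → Finset ι) (K j : ℕ) (z : γ) (Gs : Gen PEv) : ℝ :=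
  if h : (occ sh mem jstar T K ⟨j, z, Gs⟩).Nonempty then
    (occ sh mem jstar T K ⟨j, z, Gs⟩).sup' h (priceT sh C Λ' R g K)
  else 0

variable {sh : ε → PEv} {C : T4PrintedShapeBanking.Consts} {Λ' : ℝ} {R : ℕ → ℕ → ℕ} {g : ℕ → ℕ → ℝ}
  {mem : ℕ → ι → Finset (γ × Gen ε)} {jstar : ℕ → ℕ} {T : ℕ → Finset ι}

/-- **EVERY OCCUPANT'S PRICE IS BELOW THE SLOT'S LABELLED PRICE.** [folklore] -/
theorem priceT_le_yT {K : ℕ} {τ : ι} (hτ : τ ∈ badTerms mem jstar T K) {q : γ × Gen ε} (hq : q ∈ mem K τ) :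
    priceT sh C Λ' R g K q ≤
      yT sh C Λ' R g mem jstar T K q.2.rootStep q.1 (relabel (shape ∘ sh) q.2) := by
  have hmem : q ∈ occ sh mem jstar T K ⟨q.2.rootStep, q.1, relabel (shape ∘ sh) q.2⟩ :=
    mem_occ.2 ⟨τ, hτ, hq, rfl⟩
  unfold yT
  rw [dif_pos ⟨q, hmem⟩]
  exact le_sup' (priceT sh C Λ' R g K) hmem

/-- the labelled price is nonnegative (`Λ′ ≥ 0`) [folklore] -/
theorem yT_nonneg (hΛ : 0 ≤ Λ') (K j : ℕ) (z : γ) (Gs : Gen PEv) : 0 ≤ yT sh C Λ' R g mem jstar T K j z Gs := by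
  unfold yT
  split_ifs with h
  · obtain ⟨q, hq⟩ := h
    exact (priceT_nonneg sh C hΛ R g K q).trans (le_sup' (priceT sh C Λ' R g K) hq)
  · exact le_rfl

/-- **ON AN OCCUPIED SLOT THE LABELLED PRICE IS ATTAINED BY AN OCCUPANT** (the arg-max). [folklore] -/
theorem exists_occ_eq_yT {K j : ℕ} {z : γ} {Gs : Gen PEv} (h : (occ sh mem jstar T K ⟨j, z, Gs⟩).Nonempty) :
    ∃ q ∈ occ sh mem jstar T K ⟨j, z, Gs⟩, yT sh C Λ' R g mem jstar T K j z Gs = priceT sh C Λ' R g K q := by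
  obtain ⟨q, hq, heq⟩ := exists_mem_eq_sup' h (priceT sh C Λ' R g K)
  refine ⟨q, hq, ?_⟩
  unfold yT
  rw [dif_pos h, heq]

/-- on an unoccupied slot the labelled price is `0` [folklore] -/
theorem yT_of_not_nonempty {K j : ℕ} {z : γ} {Gs : Gen PEv} (h : ¬ (occ sh mem jstar T K ⟨j, z, Gs⟩).Nonempty) :
    yT sh C Λ' R g mem jstar T K j z Gs = 0 := by
  unfold yT; rw [dif_neg h]

end Price

/-! ## §3 The per-term reading and the four tree-slot binders -/

section Binders

variable {ε γ ι : Type*} [DecidableEq γ] [DecidableEq ε]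

/-- **THE PER-TERM READING OF THE LIVE STRUCTURES** (a hypothesis SHAPE, the H3∕(ID) supplier's obligations in
term-keyed form; discharged by rows S3∕S4∕S5∕S7 for the members of admissible histories).  For every cutoff `K ≥ K₀`,
every BAD term `τ ∈ T K` (an old live member) and every live member `(z, G′) ∈ mem K τ`: `G′` is a `ConsistentT`, FRESH,
PENDING tagged genealogy, its root cell is a cell of the root's age, it is CHRONOLOGICAL within the caps (birth classes
`< Dcap K`, fuel `≤ Ncap K`); and WITHIN ONE TERM distinct members sit at distinct tree slots (disjoint regions have
distinct root cells). [folklore] -/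
structure TermReading (sh : ε → PEv) (C : T4PrintedShapeBanking.Consts) (Cell : ℕ → ℕ → Finset γ)
    (Dcap Ncap : ℕ → ℕ) (jstar : ℕ → ℕ) (K₀ : ℕ) (R : ℕ → ℕ → ℕ) (T : ℕ → Finset ι)
    (mem : ℕ → ι → Finset (γ × Gen ε)) : Prop where
  /-- members are consistent tagged genealogies of their cutoff -/
  consistent : ∀ K, K₀ ≤ K → ∀ τ ∈ badTerms mem jstar T K, ∀ q ∈ mem K τ, ConsistentT sh C K (R K) q.2
  /-- members carry fresh tags -/
  fresh : ∀ K, K₀ ≤ K → ∀ τ ∈ badTerms mem jstar T K, ∀ q ∈ mem K τ, FreshT q.2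
  /-- members are pending at the cutoff -/
  pending : ∀ K, K₀ ≤ K → ∀ τ ∈ badTerms mem jstar T K, ∀ q ∈ mem K τ, K < q.2.reach (dictWT sh (R K) C.n₁)
  /-- the root cell is a cell of the root's age -/
  cell_mem : ∀ K, K₀ ≤ K → ∀ τ ∈ badTerms mem jstar T K, ∀ q ∈ mem K τ, q.1 ∈ Cell K (K - q.2.rootStep)
  /-- members are chronological -/
  chrono : ∀ K, K₀ ≤ K → ∀ τ ∈ badTerms mem jstar T K, ∀ q ∈ mem K τ, T4CanonicalMenus.Chrono (PEv.step ∘ sh) q.2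
  /-- birth classes below the class cap -/
  fat_lt : ∀ K, K₀ ≤ K → ∀ τ ∈ badTerms mem jstar T K, ∀ q ∈ mem K τ,
    ∀ e ∈ q.2.events, (sh e).kind = 0 → (sh e).fat < Dcap K
  /-- fuel below the fuel cap -/
  fuel_le : ∀ K, K₀ ≤ K → ∀ τ ∈ badTerms mem jstar T K, ∀ q ∈ mem K τ, fuel q.2 ≤ Ncap K
  /-- within one term, distinct members occupy distinct tree slots -/
  inj : ∀ K, K₀ ≤ K → ∀ τ ∈ badTerms mem jstar T K, Set.InjOn (bslotOf sh) (mem K τ : Set (γ × Gen ε))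

variable {sh : ε → PEv} {C : T4PrintedShapeBanking.Consts} {Cell : ℕ → ℕ → Finset γ} {Dcap Ncap : ℕ → ℕ}
  {jstar : ℕ → ℕ} {K₀ : ℕ} {R : ℕ → ℕ → ℕ} {T : ℕ → Finset ι} {mem : ℕ → ι → Finset (γ × Gen ε)}
  {Λ' : ℝ} {g : ℕ → ℕ → ℝ}

/-- **`hlabT` FROM THE TERM READING**: at every slot the labelled price is `0` or the price of an occupant — a
consistent, fresh, pending tagged genealogy whose shape is the slot's tree (the arg-max member). [folklore] -/
theorem hlabT_of_termReading (H : TermReading sh C Cell Dcap Ncap jstar K₀ R T mem) (F' : ℕ → ℕ → Finset (Gen PEv))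
    (K : ℕ) (hK : K₀ ≤ K) (j : ℕ) (_hj : j ≤ K) (z : γ) (_hz : z ∈ Cell K (K - j)) (Gs : Gen PEv)
    (_hG : Gs ∈ F' K j) :
    yT sh C Λ' R g mem jstar T K j z Gs ≤ 0 ∨ ∃ G' : Gen ε, ConsistentT sh C K (R K) G' ∧ FreshT G' ∧
      K < G'.reach (dictWT sh (R K) C.n₁) ∧ relabel (shape ∘ sh) G' = Gs ∧
      yT sh C Λ' R g mem jstar T K j z Gs ≤ Λ' ^ partnerAges (PEv.step ∘ sh) G' *
        (Real.exp (-credits (credit C (g K) ∘ sh) G') *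
          Real.exp (lifeCost (dictWT sh (R K) C.n₁) (costT sh C K (R K)) G')) := by
  by_cases h : (occ sh mem jstar T K ⟨j, z, Gs⟩).Nonempty
  · obtain ⟨q, hq, heq⟩ := exists_occ_eq_yT (C := C) (Λ' := Λ') (R := R) (g := g) h
    obtain ⟨τ, hτ, hqτ, hs⟩ := mem_occ.1 hq
    obtain ⟨-, -, hrel⟩ := (bslotOf_eq_iff sh q j z Gs).1 hs
    refine Or.inr ⟨q.2, H.consistent K hK τ hτ q hqτ, H.fresh K hK τ hτ q hqτ, H.pending K hK τ hτ q hqτ, hrel, ?_⟩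
    rw [heq]; exact le_of_eq rfl
  · exact Or.inl (le_of_eq (yT_of_not_nonempty h))

/-- **`hstr` FROM THE TERM READING**: a bad class consists of LIVE tree slots of the canonical run family and contains
an OLD one (`T4CanonicalMenus.mem_bliveSlots_of_chrono` ∕ `mem_boldSlots_of_chrono`). [folklore] -/
theorem hstr_of_termReading (H : TermReading sh C Cell Dcap Ncap jstar K₀ R T mem) (K : ℕ) (hK : K₀ ≤ K)
    {c : Finset (BSlot γ PEv)} (hc : c ∈ badClasses sh mem jstar T K) :
    c ⊆ bliveSlots Cell (canonFam Dcap Ncap) K ∧ ∃ o ∈ boldSlots Cell (canonFam Dcap Ncap) jstar K, o ∈ c := by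
  obtain ⟨τ, hτ, rfl⟩ := mem_badClasses.1 hc
  refine ⟨fun s hs => ?_, ?_⟩
  · obtain ⟨q, hq, rfl⟩ := mem_image.1 hs
    exact mem_bliveSlots_of_chrono Cell (H.consistent K hK τ hτ q hq) (H.chrono K hK τ hτ q hq)
      (H.fat_lt K hK τ hτ q hq) (H.fuel_le K hK τ hτ q hq) (H.cell_mem K hK τ hτ q hq)
  · obtain ⟨-, q, hq, hold⟩ := mem_badTerms.1 hτ
    exact ⟨bslotOf sh q, mem_boldSlots_of_chrono Cell jstar (H.consistent K hK τ hτ q hq) (H.chrono K hK τ hτ q hq)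
      (H.fat_lt K hK τ hτ q hq) (H.fuel_le K hK τ hτ q hq) (H.cell_mem K hK τ hτ q hq) hold,
      mem_image_of_mem _ hq⟩

/-- **`hF` FROM A PER-TERM PRICE READING**: if the live price `F·Rf` of the class of every bad term is below the PRODUCT
of its members' tree-slot prices, then it is below the family weight of the class at the labelled price (`prod_image`
along within-term injectivity, factorwise `priceT ≤ yT`). [folklore] -/
theorem hF_of_priceReading (H : TermReading sh C Cell Dcap Ncap jstar K₀ R T mem) (hΛ : 0 ≤ Λ') {l₀ : ℝ}
    {Fc Rf : ℕ → Finset (BSlot γ PEv) → ℝ}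
    (hprice : ∀ K t, |t| ≤ l₀ → K₀ ≤ K → ∀ τ ∈ badTerms mem jstar T K,
      Fc K (bstrOf sh mem K τ) * Rf K (bstrOf sh mem K τ) ≤ ∏ q ∈ mem K τ, priceT sh C Λ' R g K q)
    (K : ℕ) (t : ℝ) (ht : |t| ≤ l₀) (hK : K₀ ≤ K) :
    ∀ c ∈ badClasses sh mem jstar T K,
      Fc K c * Rf K c ≤ famWeight (bslotPrice (yT sh C Λ' R g mem jstar T K)) c := by
  intro c hc
  obtain ⟨τ, hτ, rfl⟩ := mem_badClasses.1 hc
  refine (hprice K t ht hK τ hτ).trans ?_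
  rw [famWeight, bstrOf, prod_image (H.inj K hK τ hτ)]
  refine prod_le_prod (fun q _ => priceT_nonneg sh C hΛ R g K q) fun q hq => ?_
  simp only [bslotOf, bslotPrice]
  exact priceT_le_yT hτ hq

end Binders

/-! ## §4 The END statement: the exit ∘ seam with the term reading plugged -/

section End

variable {F : T4Family} {G : Type*} [GaugeGroup G] [MeasurableSpace G] [HaarData G] [RegularGaugeGroup G]
variable {ε : Type*} [DecidableEq ε]
variable {ι : Type*} [DecidableEq ι] {l₀ vol : ℝ} {K₀ : ℕ} {T : ℕ → Finset ι} {A A' shA shB : ℕ → ℝ → ι → ℝ}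
  {dead dead' : ℕ → ℝ → ι → ℝ} {nup mup : ℕ → ℝ → ℝ} {Nup : ℝ}
  {Cc Rr CcRec RrRec : ℕ → ℝ → ι → ℝ} {ν u s₂ q₀ r s Wsh : ℕ → ℝ}

/-- **NE7b's COUNT EXIT WITH THE LIVE STRUCTURES READ PER TERM.**  `HistoryAssemblyTrees.hybridNE7_of_treeBinders_canon`
(the tree-slot exit at `D = 0`, `Δ = 1` along the tuned runs, with typed flow, cells, matching scale, rates and both
`Regeneration` runs plugged) with: the live-class map `π K τ := bstrOf sh mem K τ` (the bslot family of the term's live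
members), the bad classes `badClasses sh mem jhalf T K` (an OLD member), `bad_subset` PROVED, the labelled price `yT` and
the slot families `str K c := c` DEFINED, and the four tree-slot binders PROVED from the displayed per-term reading:
`TermReading …` (per-member facts, within-term injectivity) and the per-term price readings `hprice`∕`hprice′`.  Still
displayed: constants (+ two largeness conditions), flow side (⇐ BetaPertH), tuning, `irThresholdTH … 0 ≤ log g⁻²`, the
(2.5) side condition, the (B) side, the `Regeneration` numerator fields `up`∕`dead_nonneg`∕`resum`∕`F_nonneg` per run
over the defined classes, the seam data. [folklore] -/
theorem hybridNE7_of_termReading_canon (D : FiniteEpsData F G) (sh : ε → PEv) {C : T4PrintedShapeBanking.Consts}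
    {rr : ℕ} {β₀ : ℝ} (h : ThresholdOK C F.L rr β₀) (hμ : 0 < C.μ) (d n : ℕ) (Dcap Ncap : ℕ → ℕ)
    (hκ₁ : (d : ℝ) * Real.log F.L + 2 * Real.log 2 ≤ C.κ₁) (hE₀ : Real.log (2 + birthMass C) ≤ C.E₀)
    -- the flow side (⇐ BetaPertH, displayed) and tuning
    {γ₀ γb b β' : ℝ} {pe : ℕ} (hb : 0 ≤ b) (hlo : FlowStep.BetaLowerH b γ₀ D.βfun)
    (hhi : FlowStep.BetaUpperH β' γ₀ D.βfun) (hγ : γb ≤ γ₀) (hγβ : γb ^ 2 * β' < 1)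
    (S : B14FlowStep.SmallnessFor γb β' β₀ F.L pe) (hp₀ : C.p₀ ≤ pe) (hrr : rr ≤ pe)
    {g : ℝ} {g₀ : ℕ → ℝ} (ht : D.Tuned γb g g₀)
    (hir : irThresholdTH sh C F.L rr β₀ 0 ≤ Real.log (g ^ 2)⁻¹)
    -- the (B) side
    (hsign : B16.SignConventions D.C) {γB : ℝ} {em ep : ℝ → ℝ} (hcor : B16.Cor3With D.C γB em ep) (hγB : γb ≤ γB)
    {obs : (K : ℕ) → GaugeField (F.P K) 0 G → ℝ} {B : ℝ}
    (hobs : ∀ K, Measurable (obs K)) (hbd : ∀ K U, |obs K U| ≤ B)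
    (hα : ∀ K t, |t| ≤ l₀ → K₀ ≤ K →
      ∫ U, Real.exp (t * obs K U) * D.dens K (g₀ K) 0 U ∂fieldMeasure (F.P K) 0 G ≤ ∑ τ ∈ T K, A K t τ)
    (hα' : ∀ K t, |t| ≤ l₀ → K₀ ≤ K →
      ∫ U, Real.exp (t * obs (K + 1) U) * D.dens (K + 1) (g₀ (K + 1)) 0 U ∂fieldMeasure (F.P (K + 1)) 0 G ≤
        ∑ τ ∈ T K, A' K t τ)
    {c₀ n₁ : ℝ} (hc₀ : 0 < c₀) (hfloor : ∀ K, K₀ ≤ K → c₀ ≤ smallFieldMass D K (g₀ K))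
    (hfloor' : ∀ K, K₀ ≤ K → c₀ ≤ smallFieldMass D (K + 1) (g₀ (K + 1)))
    (hsites : ∀ K, K₀ ≤ K → ((D.C ⟨K, F.m, g₀ K⟩).numSites K : ℝ) ≤ n₁)
    (hsites' : ∀ K, K₀ ≤ K → ((D.C ⟨K + 1, F.m, g₀ (K + 1)⟩).numSites (K + 1) : ℝ) ≤ n₁)
    (hNup : 0 ≤ Nup) (hnup : ∀ K t, |t| ≤ l₀ → K₀ ≤ K → 0 ≤ nup K t ∧ nup K t ≤ Nup)
    (hmup : ∀ K t, |t| ≤ l₀ → K₀ ≤ K → 0 ≤ mup K t ∧ mup K t ≤ Nup)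
    -- the (2.5) side condition on the size function
    (R : ℕ → ℕ → ℕ) (hR : ∀ K s, s ≤ K → B14.IsRj F.L rr ((D.C ⟨K, F.m, g₀ K⟩).flow.g s) (R K s))
    -- H3, PER TERM: the live members of the terms and their reading
    (mem : ℕ → ι → Finset ((Fin d → ℕ) × Gen ε))
    (H : TermReading sh C (cellN d n F.L) Dcap Ncap jhalf K₀ R T mem)
    {Fc Rf Fc' Rf' : ℕ → Finset (BSlot (Fin d → ℕ) PEv) → ℝ}
    (hprice : ∀ K t, |t| ≤ l₀ → K₀ ≤ K → ∀ τ ∈ badTerms mem jhalf T K,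
      Fc K (bstrOf sh mem K τ) * Rf K (bstrOf sh mem K τ) ≤
        ∏ q ∈ mem K τ, priceT sh C ((F.L : ℝ) ^ d) R (fun K => (D.C ⟨K, F.m, g₀ K⟩).flow.g) K q)
    (hprice' : ∀ K t, |t| ≤ l₀ → K₀ ≤ K → ∀ τ ∈ badTerms mem jhalf T K,
      Fc' K (bstrOf sh mem K τ) * Rf' K (bstrOf sh mem K τ) ≤
        ∏ q ∈ mem K τ, priceT sh C ((F.L : ℝ) ^ d) R (fun K => (D.C ⟨K, F.m, g₀ K⟩).flow.g) K q)
    -- H3: the remaining `Regeneration` numerator readings, over the DEFINED classes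
    (up : ∀ K t, |t| ≤ l₀ → K₀ ≤ K → ∀ c ∈ badClasses sh mem jhalf T K, ∀ τ ∈ fibre (bstrOf sh mem) T K c,
      A K t τ ≤ dead K t τ * Fc K c * nup K t)
    (dead_nonneg : ∀ K t, |t| ≤ l₀ → K₀ ≤ K → ∀ c ∈ badClasses sh mem jhalf T K,
      ∀ τ ∈ fibre (bstrOf sh mem) T K c, 0 ≤ dead K t τ)
    (resum : ∀ K t, |t| ≤ l₀ → K₀ ≤ K → ∀ c ∈ badClasses sh mem jhalf T K,
      ∑ τ ∈ fibre (bstrOf sh mem) T K c, dead K t τ ≤ Rf K c)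
    (F_nonneg : ∀ K t, |t| ≤ l₀ → K₀ ≤ K → ∀ c ∈ badClasses sh mem jhalf T K, 0 ≤ Fc K c)
    (up' : ∀ K t, |t| ≤ l₀ → K₀ ≤ K → ∀ c ∈ badClasses sh mem jhalf T K, ∀ τ ∈ fibre (bstrOf sh mem) T K c,
      A' K t τ ≤ dead' K t τ * Fc' K c * mup K t)
    (dead'_nonneg : ∀ K t, |t| ≤ l₀ → K₀ ≤ K → ∀ c ∈ badClasses sh mem jhalf T K,
      ∀ τ ∈ fibre (bstrOf sh mem) T K c, 0 ≤ dead' K t τ)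
    (resum' : ∀ K t, |t| ≤ l₀ → K₀ ≤ K → ∀ c ∈ badClasses sh mem jhalf T K,
      ∑ τ ∈ fibre (bstrOf sh mem) T K c, dead' K t τ ≤ Rf' K c)
    (F'_nonneg : ∀ K t, |t| ≤ l₀ → K₀ ≤ K → ∀ c ∈ badClasses sh mem jhalf T K, 0 ≤ Fc' K c)
    -- the seam's other inputs
    (hSh : ShellWeightBound l₀ T A A' shA shB Wsh)
    (hTB : ReindexedBudget l₀ vol T (fun K t τ => A K t τ - shA K t τ) (fun K t τ => A' K t τ - shB K t τ)
      (badOfClass (bstrOf sh mem) T (fun K _ => badClasses sh mem jhalf T K)) Cc Rr CcRec RrRec ν u s₂ q₀ r s)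
    (hr : Summable r) (hu : Summable u) (hs : Summable s) (hs₂ : Summable s₂) :
    ∃ K₁ K₂, K₀ ≤ K₁ ∧ HybridNE7 l₀ vol (fun K => T (K₁ + (K₂ + K))) (fun K => A (K₁ + (K₂ + K)))
      (fun K => A' (K₁ + (K₂ + K)))
      (fun K => badOfClass (bstrOf sh mem) T (fun K _ => badClasses sh mem jhalf T K) (K₁ + (K₂ + K)))
      (fun K => constOf l₀ B (max (em g) 0) n₁ c₀ Nup *
        recordsBudget (birthMass C) C.κ₁ ((n : ℝ) ^ d) ((F.L : ℝ) ^ d) (Real.log 2) jhalf (K₁ + (K₂ + K)))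
      (fun K => shA (K₁ + (K₂ + K))) (fun K => shB (K₁ + (K₂ + K))) (fun K => Wsh (K₁ + (K₂ + K)))
      (fun K => (r (K₁ + (K₂ + K)) + u (K₁ + (K₂ + K))) + (s (K₁ + (K₂ + K)) + s₂ (K₁ + (K₂ + K)))) := by
  have hLpos : (0 : ℝ) < F.L := by exact_mod_cast (lt_of_lt_of_le (by norm_num) (two_le_L F))
  have hΛ : (0 : ℝ) ≤ (F.L : ℝ) ^ d := pow_nonneg hLpos.le d
  exact hybridNE7_of_treeBinders_canon D sh h hμ d n Dcap Ncap hκ₁ hE₀ hb hlo hhi hγ hγβ S hp₀ hrr ht hir hsign hcor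
    hγB hobs hbd hα hα' hc₀ hfloor hfloor' hsites hsites' hNup hnup hmup
    (π := bstrOf sh mem) (Bad' := fun K _ => badClasses sh mem jhalf T K)
    (fun K _ _ _ => badClasses_subset_classIndex sh mem jhalf T K) up dead_nonneg resum F_nonneg up' dead'_nonneg
    resum' F'_nonneg R hR (yT sh C ((F.L : ℝ) ^ d) R (fun K => (D.C ⟨K, F.m, g₀ K⟩).flow.g) mem jhalf T)
    (fun K j _ z _ Gs _ => yT_nonneg hΛ K j z Gs)
    (fun K hK j hj z hz Gs hGs => hlabT_of_termReading H (canonFam Dcap Ncap) K hK j hj z hz Gs hGs)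
    (fun _ c => c) (fun K t _ _ => Set.injOn_id _)
    (fun K t _ hK c hc => hstr_of_termReading H K hK hc)
    (fun K t ht hK => hF_of_priceReading H hΛ hprice K t ht hK)
    (fun K t ht hK => hF_of_priceReading H hΛ hprice' K t ht hK) hSh hTB hr hu hs hs₂

end End

end

end Summit.QuantumFields.BalabanUV.T4Continuum.HistoryAssemblyTerms
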